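/-
# PROBE 26 (pub-hlocus ivhs-2, ENGINE B gen 57) — A KERNEL SHADOW INEQUALITY FOR INCLUSION MATRICES; THE UNIT-COLUMN RANK DROP GROWS TOWARDS THE CENTRE

certified instances and evidence bearing on the general Hodge conjecture; no claim.

Anchor 304 ((DROP) `rank_charP_add_eq_rank_charZero_add`) writes the characteristic-`p` rank drop of anchor 229's multiplicity matrix of `×q^c`
on `K[x₁,…,x_k]/(xᵢ^{e+2})` at level `j` as `Σ_μ (CORR_P(μ) − CORR_0(μ))` over labels `μ : Fin k → Fin (e+1)` with Wilson blocks `W_{T,T+c}(k − S)`;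
anchors 326/330 locate the drop (zero outside the window `(e+1)(p−c) ≤ j ≤ (e+1)(k−p)`, positive inside) and anchor 312 makes it symmetric about
the centre `(e+1)(k−c)/2`.  Here, ITS SHAPE: the drop is NON-DECREASING along the lattice steps `j ↦ j + (e+1)` of the lower half.  The engine is
a general fact about the inclusion matrices `W_{t,n}(α) S T = [S ⊆ T]` over ANY field `K`:
  (KS) `kernel_shadow` — `(n+1) · dim ker W_{t+1,n+1} ≤ (#α − n) · dim ker W_{t,n}`.
The colex-leading indices of a kernel number its dimension (§1); the point operator `Del_a` (anchors PointOps/Shadows) maps `ker W_{t+1,n+1}`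
into `ker W_{t,n}` and a leading index `B ∋ a` to the leading index `B ∖ a` (§2), so the lower shadow of the leading family leads the smaller
kernel, and the local LYM inequality (Mathlib `Finset.local_lubell_yamamoto_meshalkin_inequality_mul`) bounds that shadow from below — Sperner
theory applied to kernels; no use of Wilson's theorem.  §3: rank–nullity and anchor 293's complement symmetry give, for the census blocks,
(KS-T) `(m − T)(C(m,T) − rank W_{T,T+c}) ≤ (T+1)(C(m,T+1) − rank W_{T+1,T+1+c})` (the kernel DENSITY grows with `T`) and (KS-mono): the corank
grows while `2T + 1 ≤ m`.  §4: over `ZMod p` on `Fin m`, Wilson's theorem (anchor InclusionRankLift `rank_incl_eq_sum`; periodic form (FY) of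
anchor 304) turns (KS-mono) into the binomial inequality (MONO-label) `CORR_P(m,T) + CORR_0(m,T+1) ≤ CORR_P(m,T+1) + CORR_0(m,T)` (`p > c`
prime, `2T + c + 2 ≤ m`): anchor 304's per-label drop grows up to the middle of its block.  §5: summed over labels (a feasible label steps
`t ↦ t + 1` in the same block size; anchor 320's label bounds; anchor 330's `corr0_le_corrP` for labels infeasible at `j`), for a prime `p > c`,
ANY `k`, `e`, a field `K` of characteristic `p` and a field `K₀` of characteristic `0`:
  (MONO) `rank_charZero_add_rank_charP_le` — (H1) `j + c + 2 ≤ k` ∧ (H2) `2j + (e+1)(c+2) ≤ (e+1)k`  ⟹  `rank_{K₀}(j) + rank_K(j+e+1) ≤ rank_{K₀}(j+e+1) + rank_K(j)`,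
i.e. `drop(j) ≤ drop(j+e+1)`; for `d ≤ 3` (`e ≤ 1`) this is the whole lower half: with anchor 312 the cubic drop is unimodal on each parity class.
Own numerics FIRST (`probe26/shadow_numerics.py` 526308ed657f, output 3d551f2411ae): (KS) on ACTUAL ranks of `W_{t,n}(Fin m)` over GF(2), GF(3),
GF(5), GF(7) (m ≤ 9) and ℚ (m ≤ 8): 780 instances, 0 violations (Wilson cross-check 595/595); (MONO-label) for p ∈ {2,3,5,7,11}, c < p,
2T + c + 2 ≤ m ≤ 200: 271 125 instances, 0 violations; (MONO) on anchor 304's closed form, p ∈ {2,3,5,7}, 1 ≤ c < p, e ≤ 6, k ≤ 30/24/20/18: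
13 485 lattice steps under (H1)∧(H2), 0 violations (13 701 further steps under (H2) alone: 0 violations — not claimed here).
EVIDENCE CLASS: kernel theorems about the census matrices; no census number changes; nothing here asserts anything about the Hodge conjecture.

Import: anchor 330 `…Theorems.HodgeLocusCensusUnitColumnRankDropWindowInterior` (hence 320, 304 (DROP)/(FY), 293, InclusionRankLift/Shadows/PointOps).
-/
import Summits.HodgeConjecture.HodgeConjecture.Theorems.HodgeLocusCensusUnitColumnRankDropWindowInterior

set_option linter.dupNamespace false
set_option autoImplicit false

namespace Summit.HodgeConjecture.HodgeConjecture.HodgeLocus.Census.UnitColumnRankDropMonotone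

open Module
open Summit.HodgeConjecture.HodgeConjecture.HodgeLocus.Census.ModelNonJumpC1All (colR)
open Summit.HodgeConjecture.HodgeConjecture.HodgeLocus.Census.InclusionRankPointOps (del_mulVecLin_apply)
open Summit.HodgeConjecture.HodgeConjecture.HodgeLocus.Census.InclusionRankShadows (incl_del_eq_zero)
open Summit.HodgeConjecture.HodgeConjecture.HodgeLocus.Census.InclusionRankComplement (rank_incl_eq_rank_incl_compl)

/-! ## §1 leading indices: `dim V ≤ #L` when `V` injects into `K^L`, and `#L ≤ dim V` when every index of `L` leads -/

variable (K : Type*) [Field K] {ι β : Type*} [Fintype ι] [LinearOrder β]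

/-- (L1) if the vectors of `V ≤ K^ι` are determined by their values on `L` (restriction to `L` injective on `V`), then `dim V ≤ #L`. -/
theorem finrank_le_card_of_eq_zero (V : Submodule K (ι → K)) (L : Finset ι) (hL : ∀ v ∈ V, (∀ i ∈ L, v i = 0) → v = 0) :
    finrank K V ≤ L.card := by
  let r : V →ₗ[K] (L → K) := LinearMap.pi fun l => (LinearMap.proj l.1).comp V.subtype
  have hinj : Function.Injective r := fun v w hvw => Subtype.ext (sub_eq_zero.mp (hL (v.1 - w.1) (V.sub_mem v.2 w.2) (fun i hi => by
    have := congrFun hvw ⟨i, hi⟩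
    simp only [r, LinearMap.pi_apply, LinearMap.comp_apply, LinearMap.proj_apply, Submodule.subtype_apply] at this
    rw [Pi.sub_apply, this, sub_self])))
  calc finrank K V ≤ finrank K (L → K) := LinearMap.finrank_le_finrank_of_injective hinj
    _ = L.card := by rw [finrank_fintype_fun_eq_card, Fintype.card_coe]

/-- (L2) if EVERY `i ∈ L` LEADS `V` along an injective `φ : ι → β` into a linear order (some `v ∈ V` has `v i ≠ 0` and `v i' = 0` whenever
`φ i < φ i'`), then `#L ≤ dim V`: vectors with distinct leading indices are independent (evaluate a dependency at the `φ`-largest active lead). -/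
theorem card_le_finrank_of_lead (φ : ι → β) (hφ : Function.Injective φ) (V : Submodule K (ι → K)) (L : Finset ι)
    (hL : ∀ i ∈ L, ∃ v ∈ V, v i ≠ 0 ∧ ∀ i', φ i < φ i' → v i' = 0) :
    L.card ≤ finrank K V := by
  classical
  choose! w hwV hwi hwlt using hL
  have hli : LinearIndependent K (fun l : L => w l.1) := by
    rw [Fintype.linearIndependent_iff]
    intro g hg
    by_contra hne
    obtain ⟨l₁, hl₁⟩ := not_forall.mp hne
    obtain ⟨l₀, hl₀, hmax⟩ := Finset.exists_max_image (Finset.univ.filter (fun l : L => g l ≠ 0)) (fun l : L => φ l.1)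
      ⟨l₁, Finset.mem_filter.mpr ⟨Finset.mem_univ _, hl₁⟩⟩
    have hg0 : g l₀ ≠ 0 := (Finset.mem_filter.mp hl₀).2
    have h := congrFun hg l₀.1
    rw [Finset.sum_apply, Finset.sum_eq_single l₀, Pi.smul_apply, smul_eq_mul, Pi.zero_apply] at h
    · exact (mul_ne_zero hg0 (hwi l₀.1 l₀.2)) h
    · intro l _ hl
      rw [Pi.smul_apply, smul_eq_mul]
      by_cases hgl : g l = 0
      · rw [hgl, zero_mul]
      · have hle : φ l.1 ≤ φ l₀.1 := hmax l (Finset.mem_filter.mpr ⟨Finset.mem_univ _, hgl⟩)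
        have hlt : φ l.1 < φ l₀.1 := lt_of_le_of_ne hle (fun h => hl (Subtype.ext (hφ h)))
        rw [hwlt l.1 l.2 l₀.1 hlt, mul_zero]
    · exact fun h => absurd (Finset.mem_univ _) h
  have hli' : LinearIndependent K (fun l : L => (⟨w l.1, hwV l.1 l.2⟩ : V)) := LinearIndependent.of_comp V.subtype hli
  simpa only [Fintype.card_coe] using hli'.fintype_card_le_finrank

/-! ## §2 colex leads of `Del_a x` (colex order transported along an injection `ρ : α → ℕ`) -/

variable {α : Type*} [Fintype α] [DecidableEq α]

/-- (D1) order the `k`-subsets of `α` by the colex order of their images under an injection `ρ : α → ℕ`. If `B` (an `(n+1)`-set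
containing `a`) is the LEADING index of `x` (`x B ≠ 0`, and `x B₂ = 0` whenever `B <_colex B₂`), then `B.erase a` is the leading index of
`Del_a x` (`(Del_a x) B' = [a ∉ B'] x (B' ∪ a)`, anchor PointOps `del_mulVecLin_apply`; colex is insensitive to removing `ρ a` from both sides,
`Finset.Colex.toColex_sdiff_lt_toColex_sdiff`). -/
theorem del_lead (ρ : α → ℕ) (hρ : Function.Injective ρ) (a : α) (n : ℕ) (x : {S : Finset α // S.card = n + 1} → K)
    (B : {S : Finset α // S.card = n + 1}) (ha : a ∈ B.1) (hB : x B ≠ 0)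
    (hlt : ∀ B₂ : {S : Finset α // S.card = n + 1}, toColex (B.1.image ρ) < toColex (B₂.1.image ρ) → x B₂ = 0) :
    Matrix.mulVecLin (Matrix.of fun (B' : {S : Finset α // S.card = n}) (B : {S : Finset α // S.card = n + 1}) =>
        if B.1 = insert a B'.1 then (1 : K) else 0) x ⟨B.1.erase a, by rw [Finset.card_erase_of_mem ha, B.2, Nat.add_sub_cancel]⟩ ≠ 0 ∧
      ∀ B'' : {S : Finset α // S.card = n}, toColex ((B.1.erase a).image ρ) < toColex (B''.1.image ρ) →
        Matrix.mulVecLin (Matrix.of fun (B' : {S : Finset α // S.card = n}) (B : {S : Finset α // S.card = n + 1}) =>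
          if B.1 = insert a B'.1 then (1 : K) else 0) x B'' = 0 := by
  constructor
  · rw [del_mulVecLin_apply, dif_neg (Finset.notMem_erase a B.1)]
    have h : (⟨insert a (B.1.erase a), by rw [Finset.card_insert_of_notMem (Finset.notMem_erase a B.1),
        Finset.card_erase_of_mem ha, B.2, Nat.add_sub_cancel]⟩ : {S : Finset α // S.card = n + 1}) = B :=
      Subtype.ext (Finset.insert_erase ha)
    rwa [h]
  · intro B'' hB''
    rw [del_mulVecLin_apply]
    split_ifs with ha''
    · rfl
    · apply hlt
      have hρa : ρ a ∉ B''.1.image ρ := fun h => ha'' ((hρ.mem_finset_image).mp h)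
      rw [Finset.image_erase hρ, ← Finset.sdiff_singleton_eq_erase] at hB''
      have h2 : B''.1.image ρ = (insert (ρ a) (B''.1.image ρ)) \ {ρ a} := by
        rw [Finset.insert_sdiff_of_mem _ (Finset.mem_singleton_self (ρ a)), Finset.sdiff_singleton_eq_erase,
          Finset.erase_eq_of_notMem hρa]
      rw [h2, Finset.Colex.toColex_sdiff_lt_toColex_sdiff (Finset.singleton_subset_iff.mpr (Finset.mem_image_of_mem ρ ha))
        (Finset.singleton_subset_iff.mpr (Finset.mem_insert_self (ρ a) _)), ← Finset.image_insert] at hB''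
      exact hB''

/-! ## §3 THE KERNEL SHADOW INEQUALITY -/

/-- **(KS) KERNEL SHADOW INEQUALITY.** For the inclusion matrices `W_{t,n}(α) S T = [S ⊆ T]` (`#S = t`, `#T = n`; W-convention of anchors
204/230/231/271/286–293) over ANY field `K` and all `t, n` (passed as `t' = t + 1`, `n' = n + 1`; kernels of the column action `x ↦ W x`):
`(n+1) · dim ker W_{t+1,n+1} ≤ (#α − n) · dim ker W_{t,n}`. PROOF: the colex-leading indices `L` of `ker W_{t+1,n+1}` number at least its
dimension (L1); their lower shadow `∂L` consists of leading indices of `ker W_{t,n}` ((D1): `Del_a` maps kernel to kernel, anchor Shadows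
`incl_del_eq_zero`), so `#∂L ≤ dim ker W_{t,n}` (L2); and `#L · (n+1) ≤ #∂L · (#α − n)` is the local LYM inequality
`Finset.local_lubell_yamamoto_meshalkin_inequality_mul` (Mathlib). A linear-algebra shadow of Sperner's lemma; no use of Wilson's theorem. -/
theorem kernel_shadow (t t' n n' : ℕ) (ht : t' = t + 1) (hn : n' = n + 1) :
    n' * finrank K (LinearMap.ker (Matrix.mulVecLin (Matrix.of fun (S : {S : Finset α // S.card = t'})
        (T : {S : Finset α // S.card = n'}) => if S.1 ⊆ T.1 then (1 : K) else 0))) ≤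
      (Fintype.card α - n) * finrank K (LinearMap.ker (Matrix.mulVecLin (Matrix.of fun (S : {S : Finset α // S.card = t})
        (T : {S : Finset α // S.card = n}) => if S.1 ⊆ T.1 then (1 : K) else 0))) := by
  classical
  subst ht hn
  obtain ⟨ρ, hρ⟩ : ∃ ρ : α → ℕ, Function.Injective ρ :=
    ⟨fun a => ((Fintype.equivFin α) a : ℕ), fun a b h => (Fintype.equivFin α).injective (Fin.ext h)⟩
  set N₁ := LinearMap.ker (Matrix.mulVecLin (Matrix.of fun (S : {S : Finset α // S.card = t + 1})
        (T : {S : Finset α // S.card = n + 1}) => if S.1 ⊆ T.1 then (1 : K) else 0)) with hN₁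
  set N₀ := LinearMap.ker (Matrix.mulVecLin (Matrix.of fun (S : {S : Finset α // S.card = t})
        (T : {S : Finset α // S.card = n}) => if S.1 ⊆ T.1 then (1 : K) else 0)) with hN₀
  set L₁ : Finset {S : Finset α // S.card = n + 1} := Finset.univ.filter (fun B => ∃ x ∈ N₁, x B ≠ 0 ∧
      ∀ B₂ : {S : Finset α // S.card = n + 1}, toColex (B.1.image ρ) < toColex (B₂.1.image ρ) → x B₂ = 0) with hL₁
  have h1 : finrank K N₁ ≤ L₁.card := by
    refine finrank_le_card_of_eq_zero K N₁ L₁ (fun v hv hvL => ?_)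
    by_contra hne
    obtain ⟨B₁, hB₁⟩ := Function.ne_iff.mp hne
    obtain ⟨B₀, hB₀, hmax⟩ := Finset.exists_max_image (Finset.univ.filter (fun B => v B ≠ 0))
      (fun B : {S : Finset α // S.card = n + 1} => toColex (B.1.image ρ)) ⟨B₁, Finset.mem_filter.mpr ⟨Finset.mem_univ _, hB₁⟩⟩
    have hB₀' : v B₀ ≠ 0 := (Finset.mem_filter.mp hB₀).2
    refine hB₀' (hvL B₀ ?_)
    rw [hL₁, Finset.mem_filter]
    refine ⟨Finset.mem_univ _, v, hv, hB₀', fun B₂ hB₂ => ?_⟩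
    by_contra hvB₂
    exact absurd (hmax B₂ (Finset.mem_filter.mpr ⟨Finset.mem_univ _, hvB₂⟩)) (not_le.mpr hB₂)
  set 𝒜 : Finset (Finset α) := L₁.image Subtype.val with h𝒜
  have hcardA : 𝒜.card = L₁.card := Finset.card_image_of_injective _ Subtype.val_injective
  have hsized : (𝒜 : Set (Finset α)).Sized (n + 1) := fun B hB => by
    obtain ⟨B', _, rfl⟩ := Finset.mem_image.mp (Finset.mem_coe.mp hB); exact B'.2
  have hLYM := Finset.local_lubell_yamamoto_meshalkin_inequality_mul hsized
  set L₀ : Finset {S : Finset α // S.card = n} := (Finset.shadow 𝒜).subtype (fun S => S.card = n) with hL₀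
  have hcard0 : L₀.card = (Finset.shadow 𝒜).card := by
    rw [hL₀, Finset.card_subtype, Finset.filter_true_of_mem]; exact fun B' hB' => Set.Sized.shadow hsized hB'
  have h2 : L₀.card ≤ finrank K N₀ := by
    refine card_le_finrank_of_lead K (fun B' : {S : Finset α // S.card = n} => toColex (B'.1.image ρ))
      (fun B₁ B₂ h => Subtype.ext (Finset.image_injective hρ (toColex_inj.mp h))) N₀ L₀ (fun B' hB' => ?_)
    rw [hL₀, Finset.mem_subtype, Finset.mem_shadow_iff] at hB'
    obtain ⟨B, hB, a, ha, hBa⟩ := hB'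
    rw [h𝒜, Finset.mem_image] at hB
    obtain ⟨B₁, hB₁, rfl⟩ := hB
    rw [hL₁, Finset.mem_filter] at hB₁
    obtain ⟨_, x, hx, hxB, hxlt⟩ := hB₁
    have hD := del_lead K ρ hρ a n x B₁ ha hxB hxlt
    have hB'eq : B' = ⟨B₁.1.erase a, by rw [Finset.card_erase_of_mem ha, B₁.2, Nat.add_sub_cancel]⟩ := Subtype.ext hBa.symm
    refine ⟨_, ?_, hB'eq ▸ hD.1, fun B'' hB'' => hD.2 B'' (by rw [hB'eq] at hB''; exact hB'')⟩
    rw [hN₀, LinearMap.mem_ker]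
    exact incl_del_eq_zero K a t n x (LinearMap.mem_ker.mp hx)
  by_cases hn : n < Fintype.card α
  · have he : Fintype.card α - (n + 1) + 1 = Fintype.card α - n := by omega
    rw [he] at hLYM
    calc (n + 1) * finrank K N₁ ≤ (n + 1) * L₁.card := Nat.mul_le_mul_left _ h1
      _ = 𝒜.card * (n + 1) := by rw [hcardA, Nat.mul_comm]
      _ ≤ (Finset.shadow 𝒜).card * (Fintype.card α - n) := hLYM
      _ ≤ finrank K N₀ * (Fintype.card α - n) := Nat.mul_le_mul_right _ (hcard0 ▸ h2)
      _ = (Fintype.card α - n) * finrank K N₀ := Nat.mul_comm _ _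
  · have h0 : finrank K N₁ = 0 := Nat.eq_zero_of_le_zero ((Submodule.finrank_le N₁).trans_eq (by
      rw [finrank_fintype_fun_eq_card, Fintype.card_finset_len]; exact Nat.choose_eq_zero_of_lt (by omega)))
    rw [h0, Nat.mul_zero]; exact Nat.zero_le _

/-- rank–nullity for `W_{t,n}(α)`: `rank W_{t,n} + dim ker W_{t,n} = C(#α, n)` (the kernel of the column action lives on the `n`-sets). -/
theorem rank_add_finrank_ker (t n : ℕ) :
    (Matrix.of fun (S : {S : Finset α // S.card = t}) (T : {S : Finset α // S.card = n}) => if S.1 ⊆ T.1 then (1 : K) else 0).rank +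
      finrank K (LinearMap.ker (Matrix.mulVecLin (Matrix.of fun (S : {S : Finset α // S.card = t})
        (T : {S : Finset α // S.card = n}) => if S.1 ⊆ T.1 then (1 : K) else 0))) = (Fintype.card α).choose n := by
  have h := LinearMap.finrank_range_add_finrank_ker (Matrix.mulVecLin (Matrix.of fun (S : {S : Finset α // S.card = t})
        (T : {S : Finset α // S.card = n}) => if S.1 ⊆ T.1 then (1 : K) else 0))
  rw [finrank_fintype_fun_eq_card, Fintype.card_finset_len] at h
  exact h

/-- **(KS-rank)** the kernel shadow inequality in RANK FORM: `(n+1) · (C(#α,n+1) − rank W_{t+1,n+1}) ≤ (#α − n) · (C(#α,n) − rank W_{t,n})`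
(any field; `t' = t + 1`, `n' = n + 1`). -/
theorem kernel_shadow_rank (t t' n n' : ℕ) (ht : t' = t + 1) (hn : n' = n + 1) :
    n' * ((Fintype.card α).choose n' -
        (Matrix.of fun (S : {S : Finset α // S.card = t'}) (T : {S : Finset α // S.card = n'}) => if S.1 ⊆ T.1 then (1 : K) else 0).rank) ≤
      (Fintype.card α - n) * ((Fintype.card α).choose n -
        (Matrix.of fun (S : {S : Finset α // S.card = t}) (T : {S : Finset α // S.card = n}) => if S.1 ⊆ T.1 then (1 : K) else 0).rank) := by
  rw [← Nat.eq_sub_of_add_eq' (rank_add_finrank_ker K (α := α) t' n'), ← Nat.eq_sub_of_add_eq' (rank_add_finrank_ker K (α := α) t n)]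
  exact kernel_shadow K (α := α) t t' n n' ht hn

/-- **(KS-T)** THE FORM USED BY THE CENSUS (blocks `W_{T,T+c}`, rows the `T`-sets): for `T + 1 + c ≤ #α =: m`,
`(m − T) · (C(m,T) − rank W_{T,T+c}) ≤ (T+1) · (C(m,T+1) − rank W_{T+1,T+1+c})` — (KS-rank) for `W_{m−T−c,m−T}` and `W_{m−T−1−c,m−T−1}`
carried over by the complement symmetry `rank W_{t,n} = rank W_{m−n,m−t}` (anchor 293 `rank_incl_eq_rank_incl_compl`); `C(m,T) − rank W_{T,T+c}`
is the dimension of the ROW kernel `{z : Σ_{S ⊆ U} z_S = 0 ∀ U}` of the block, so (KS-T) says the row-kernel DENSITY grows with `T`. -/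
theorem kernel_shadow_block (T c : ℕ) (hT : T + 1 + c ≤ Fintype.card α) :
    (Fintype.card α - T) * ((Fintype.card α).choose T -
        (Matrix.of fun (S : {S : Finset α // S.card = T}) (U : {S : Finset α // S.card = T + c}) => if S.1 ⊆ U.1 then (1 : K) else 0).rank) ≤
      (T + 1) * ((Fintype.card α).choose (T + 1) -
        (Matrix.of fun (S : {S : Finset α // S.card = T + 1}) (U : {S : Finset α // S.card = T + 1 + c}) =>
          if S.1 ⊆ U.1 then (1 : K) else 0).rank) := by
  have h := kernel_shadow_rank K (α := α) (Fintype.card α - (T + 1 + c)) (Fintype.card α - (T + c))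
    (Fintype.card α - (T + 1)) (Fintype.card α - T) (by omega) (by omega)
  rw [← rank_incl_eq_rank_incl_compl K T (T + c) (by omega) (by omega),
    ← rank_incl_eq_rank_incl_compl K (T + 1) (T + 1 + c) (by omega) hT,
    Nat.choose_symm (show T ≤ Fintype.card α by omega), Nat.choose_symm (show T + 1 ≤ Fintype.card α by omega),
    Nat.sub_sub_self (show T + 1 ≤ Fintype.card α by omega)] at h
  exact h

/-- **(KS-mono) THE ROW KERNEL OF THE BLOCKS GROWS UP TO THE MIDDLE**: `C(m,T) − rank W_{T,T+c} ≤ C(m,T+1) − rank W_{T+1,T+1+c}` for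
`2T + 1 ≤ m` and `T + 1 + c ≤ m` (any field). -/
theorem corank_le_corank_succ (T c : ℕ) (hT : T + 1 + c ≤ Fintype.card α) (h2 : 2 * T + 1 ≤ Fintype.card α) :
    (Fintype.card α).choose T -
        (Matrix.of fun (S : {S : Finset α // S.card = T}) (U : {S : Finset α // S.card = T + c}) => if S.1 ⊆ U.1 then (1 : K) else 0).rank ≤
      (Fintype.card α).choose (T + 1) -
        (Matrix.of fun (S : {S : Finset α // S.card = T + 1}) (U : {S : Finset α // S.card = T + 1 + c}) =>
          if S.1 ⊆ U.1 then (1 : K) else 0).rank := by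
  exact Nat.le_of_mul_le_mul_left (le_trans (Nat.mul_le_mul_right _ (by omega)) (kernel_shadow_block K (α := α) T c hT)) (Nat.succ_pos T)

/-! ## §4 THE PER-LABEL DROP GROWS UP TO THE MIDDLE OF ITS BLOCK — a binomial inequality proved by linear algebra -/

/-- **(MONO-label)** for a prime `p > c` and `2T + c + 2 ≤ m`:
`Σ_{1 ≤ b ≤ (T+c)/p} C(m, T+c−bp) + Σ_{1 ≤ b ≤ (T+1)/p} C(m, T+1−bp) ≤ Σ_{1 ≤ b ≤ (T+1+c)/p} C(m, T+1+c−bp) + Σ_{1 ≤ b ≤ T/p} C(m, T−bp)`,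
i.e. anchor 304's per-label drop `CORR_P(m,T) − CORR_0(m,T)` is NON-DECREASING in `T` up to the middle of the block — a statement about binomial
multisections PROVED BY LINEAR ALGEBRA: over `K = ZMod p` on `α = Fin m` it is (KS-mono), since `CORR_P − CORR_0 = C(m,T) − rank W_{T,T+c}`
(Wilson's theorem, anchor InclusionRankLift `rank_incl_eq_sum`, in the periodic form (FY) `wilson_sum_add_eq` of anchor 304). -/
theorem corr_add_corr_le (p : ℕ) (hp : p.Prime) (c m T : ℕ) (hcp : c < p) (hT : 2 * T + c + 2 ≤ m) :
    (∑ b ∈ Finset.range ((T + c) / p), m.choose (T + c - (b + 1) * p)) + ∑ b ∈ Finset.range ((T + 1) / p), m.choose (T + 1 - (b + 1) * p) ≤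
      (∑ b ∈ Finset.range ((T + 1 + c) / p), m.choose (T + 1 + c - (b + 1) * p)) + ∑ b ∈ Finset.range (T / p), m.choose (T - (b + 1) * p) := by
  haveI := Fact.mk hp
  have hW := InclusionRankLift.rank_incl_eq_sum (ZMod p) (α := Fin m) p T (T + c) (Nat.le_add_right T c)
    (by rw [Fintype.card_fin]; omega)
  have hW' := InclusionRankLift.rank_incl_eq_sum (ZMod p) (α := Fin m) p (T + 1) (T + 1 + c) (Nat.le_add_right _ c)
    (by rw [Fintype.card_fin]; omega)
  have hr := Matrix.rank_le_card_height (Matrix.of fun (S : {S : Finset (Fin m) // S.card = T})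
    (U : {S : Finset (Fin m) // S.card = T + c}) => if S.1 ⊆ U.1 then (1 : ZMod p) else 0)
  have hr' := Matrix.rank_le_card_height (Matrix.of fun (S : {S : Finset (Fin m) // S.card = T + 1})
    (U : {S : Finset (Fin m) // S.card = T + 1 + c}) => if S.1 ⊆ U.1 then (1 : ZMod p) else 0)
  have hmono := corank_le_corank_succ (ZMod p) (α := Fin m) T c (by rw [Fintype.card_fin]; omega) (by rw [Fintype.card_fin]; omega)
  simp only [Fintype.card_finset_len, Fintype.card_fin] at hW hW' hr hr' hmono
  have hFY := UnitColumnRankDrop.wilson_sum_add_eq hp hcp m T (T + c) rfl (by omega)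
  have hFY' := UnitColumnRankDrop.wilson_sum_add_eq hp hcp m (T + 1) (T + 1 + c) rfl (by omega)
  omega

/-! ## §5 THE CENSUS: THE MODULAR RANK DROP OF THE UNIT COLUMN GROWS ALONG THE LATTICE STEPS OF THE LOWER WINDOW -/

/-- (MONO-summand) anchor 304's label summands at the levels `j` and `j + (e+1)` compare termwise: for a prime `p > c`, (H1) `j + c + 2 ≤ k` and
(H2) `2j + (e+1)(c+2) ≤ (e+1)k`, `CORR_P(μ, j) + CORR_0(μ, j+e+1) ≤ CORR_P(μ, j+e+1) + CORR_0(μ, j)` for every label `μ`. A label feasible at `j`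
is feasible at `j + (e+1)` with `t ↦ t + 1` and the same `m = k − s`; (H1)/(H2) with `s ≤ Σμ ≤ e·s` (anchor 320 (LB)/(UB)) give `2(t+1) + c ≤ m`,
so both blocks sit below their middle (`T = t`, `T' = t + 1`) and (MONO-label) applies; a block non-empty at `j` and empty at `j + (e+1)` has
`T = 0` and no correction (`c < p`); a label infeasible at `j` contributes `CORR_0 ≤ CORR_P` at `j + (e+1)` (anchor 330 `corr0_le_corrP`). -/
theorem summand_add_summand_le (p k e c j : ℕ) (μ : Fin k → Fin (e + 1)) (hp : p.Prime) (hcp : c < p) (h1 : j + c + 2 ≤ k)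
    (h2 : 2 * j + (e + 1) * (c + 2) ≤ (e + 1) * k) :
    (if (e + 1) ∣ (j + ∑ i, (μ i : ℕ)) ∧ (e + 1) * (Finset.univ.filter (fun l => (μ l : ℕ) ≠ 0)).card ≤ j + ∑ i, (μ i : ℕ) then
      (if k - (Finset.univ.filter (fun l => (μ l : ℕ) ≠ 0)).card < (j + ∑ i, (μ i : ℕ)) / (e + 1) - (Finset.univ.filter (fun l => (μ l : ℕ) ≠ 0)).card + c then 0
       else ∑ b ∈ Finset.range ((min ((j + ∑ i, (μ i : ℕ)) / (e + 1) - (Finset.univ.filter (fun l => (μ l : ℕ) ≠ 0)).card)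
           (k - (Finset.univ.filter (fun l => (μ l : ℕ) ≠ 0)).card -
             ((j + ∑ i, (μ i : ℕ)) / (e + 1) - (Finset.univ.filter (fun l => (μ l : ℕ) ≠ 0)).card) - c) + c) / p),
         (k - (Finset.univ.filter (fun l => (μ l : ℕ) ≠ 0)).card).choose
           (min ((j + ∑ i, (μ i : ℕ)) / (e + 1) - (Finset.univ.filter (fun l => (μ l : ℕ) ≠ 0)).card)
             (k - (Finset.univ.filter (fun l => (μ l : ℕ) ≠ 0)).card -
               ((j + ∑ i, (μ i : ℕ)) / (e + 1) - (Finset.univ.filter (fun l => (μ l : ℕ) ≠ 0)).card) - c) + c - (b + 1) * p))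
     else 0) +
    (if (e + 1) ∣ (j + (e + 1) + ∑ i, (μ i : ℕ)) ∧ (e + 1) * (Finset.univ.filter (fun l => (μ l : ℕ) ≠ 0)).card ≤ j + (e + 1) + ∑ i, (μ i : ℕ) then
      (if k - (Finset.univ.filter (fun l => (μ l : ℕ) ≠ 0)).card < (j + (e + 1) + ∑ i, (μ i : ℕ)) / (e + 1) - (Finset.univ.filter (fun l => (μ l : ℕ) ≠ 0)).card + c then 0
       else ∑ b ∈ Finset.range ((min ((j + (e + 1) + ∑ i, (μ i : ℕ)) / (e + 1) - (Finset.univ.filter (fun l => (μ l : ℕ) ≠ 0)).card)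
           (k - (Finset.univ.filter (fun l => (μ l : ℕ) ≠ 0)).card -
             ((j + (e + 1) + ∑ i, (μ i : ℕ)) / (e + 1) - (Finset.univ.filter (fun l => (μ l : ℕ) ≠ 0)).card) - c)) / p),
         (k - (Finset.univ.filter (fun l => (μ l : ℕ) ≠ 0)).card).choose
           (min ((j + (e + 1) + ∑ i, (μ i : ℕ)) / (e + 1) - (Finset.univ.filter (fun l => (μ l : ℕ) ≠ 0)).card)
             (k - (Finset.univ.filter (fun l => (μ l : ℕ) ≠ 0)).card -
               ((j + (e + 1) + ∑ i, (μ i : ℕ)) / (e + 1) - (Finset.univ.filter (fun l => (μ l : ℕ) ≠ 0)).card) - c) - (b + 1) * p))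
     else 0) ≤
    (if (e + 1) ∣ (j + (e + 1) + ∑ i, (μ i : ℕ)) ∧ (e + 1) * (Finset.univ.filter (fun l => (μ l : ℕ) ≠ 0)).card ≤ j + (e + 1) + ∑ i, (μ i : ℕ) then
      (if k - (Finset.univ.filter (fun l => (μ l : ℕ) ≠ 0)).card < (j + (e + 1) + ∑ i, (μ i : ℕ)) / (e + 1) - (Finset.univ.filter (fun l => (μ l : ℕ) ≠ 0)).card + c then 0
       else ∑ b ∈ Finset.range ((min ((j + (e + 1) + ∑ i, (μ i : ℕ)) / (e + 1) - (Finset.univ.filter (fun l => (μ l : ℕ) ≠ 0)).card)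
           (k - (Finset.univ.filter (fun l => (μ l : ℕ) ≠ 0)).card -
             ((j + (e + 1) + ∑ i, (μ i : ℕ)) / (e + 1) - (Finset.univ.filter (fun l => (μ l : ℕ) ≠ 0)).card) - c) + c) / p),
         (k - (Finset.univ.filter (fun l => (μ l : ℕ) ≠ 0)).card).choose
           (min ((j + (e + 1) + ∑ i, (μ i : ℕ)) / (e + 1) - (Finset.univ.filter (fun l => (μ l : ℕ) ≠ 0)).card)
             (k - (Finset.univ.filter (fun l => (μ l : ℕ) ≠ 0)).card -
               ((j + (e + 1) + ∑ i, (μ i : ℕ)) / (e + 1) - (Finset.univ.filter (fun l => (μ l : ℕ) ≠ 0)).card) - c) + c - (b + 1) * p))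
     else 0) +
    (if (e + 1) ∣ (j + ∑ i, (μ i : ℕ)) ∧ (e + 1) * (Finset.univ.filter (fun l => (μ l : ℕ) ≠ 0)).card ≤ j + ∑ i, (μ i : ℕ) then
      (if k - (Finset.univ.filter (fun l => (μ l : ℕ) ≠ 0)).card < (j + ∑ i, (μ i : ℕ)) / (e + 1) - (Finset.univ.filter (fun l => (μ l : ℕ) ≠ 0)).card + c then 0
       else ∑ b ∈ Finset.range ((min ((j + ∑ i, (μ i : ℕ)) / (e + 1) - (Finset.univ.filter (fun l => (μ l : ℕ) ≠ 0)).card)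
           (k - (Finset.univ.filter (fun l => (μ l : ℕ) ≠ 0)).card -
             ((j + ∑ i, (μ i : ℕ)) / (e + 1) - (Finset.univ.filter (fun l => (μ l : ℕ) ≠ 0)).card) - c)) / p),
         (k - (Finset.univ.filter (fun l => (μ l : ℕ) ≠ 0)).card).choose
           (min ((j + ∑ i, (μ i : ℕ)) / (e + 1) - (Finset.univ.filter (fun l => (μ l : ℕ) ≠ 0)).card)
             (k - (Finset.univ.filter (fun l => (μ l : ℕ) ≠ 0)).card -
               ((j + ∑ i, (μ i : ℕ)) / (e + 1) - (Finset.univ.filter (fun l => (μ l : ℕ) ≠ 0)).card) - c) - (b + 1) * p))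
     else 0) := by
  have hUB := UnitColumnRankDropBandProfile.sum_label_le_mul_card_filter k e μ
  have hLB := UnitColumnRankDropBandProfile.card_filter_le_sum_label k e μ
  by_cases hF : (e + 1) ∣ (j + ∑ i, (μ i : ℕ)) ∧ (e + 1) * (Finset.univ.filter (fun l => (μ l : ℕ) ≠ 0)).card ≤ j + ∑ i, (μ i : ℕ)
  swap
  · rw [if_neg hF, if_neg hF, zero_add, add_zero]
    exact UnitColumnRankDropWindowInterior.corr0_le_corrP p k e c (j + (e + 1)) μ hcp
  · have hF' : (e + 1) ∣ (j + (e + 1) + ∑ i, (μ i : ℕ)) ∧ (e + 1) * (Finset.univ.filter (fun l => (μ l : ℕ) ≠ 0)).card ≤ j + (e + 1) + ∑ i, (μ i : ℕ) := by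
      refine ⟨?_, by omega⟩
      rw [show j + (e + 1) + ∑ i, (μ i : ℕ) = (j + ∑ i, (μ i : ℕ)) + (e + 1) by ring]
      exact dvd_add hF.1 (dvd_refl _)
    rw [if_pos hF, if_pos hF, if_pos hF', if_pos hF']
    generalize hS : (Finset.univ.filter (fun l => (μ l : ℕ) ≠ 0)).card = S at *
    generalize hσ : (∑ i, (μ i : ℕ)) = σ at *
    obtain ⟨q, hq⟩ := hF.1
    have hq1 : (j + σ) / (e + 1) = q := by
      rw [hq, Nat.mul_div_cancel_left _ (Nat.succ_pos e)]
    have hq2 : (j + (e + 1) + σ) / (e + 1) = q + 1 := by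
      rw [show j + (e + 1) + σ = (e + 1) * (q + 1) by rw [Nat.mul_succ, ← hq]; ring, Nat.mul_div_cancel_left _ (Nat.succ_pos e)]
    rw [hq1, hq2]
    have hSq : S ≤ q := Nat.le_of_mul_le_mul_left (by rw [← hq]; exact hF.2) (Nat.succ_pos e)
    by_cases hE : k - S < (q - S) + c
    · have hE' : k - S < (q + 1 - S) + c := by omega
      rw [if_pos hE, if_pos hE', zero_add]
      exact Nat.zero_le _
    · rw [if_neg hE, if_neg hE]
      by_cases hE' : k - S < (q + 1 - S) + c
      · rw [if_pos hE', if_pos hE', add_zero, zero_add]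
        have hT0 : min (q - S) (k - S - (q - S) - c) = 0 := by
          rw [show k - S - (q - S) - c = 0 by omega, Nat.min_zero]
        rw [hT0, Nat.zero_add, Nat.div_eq_of_lt hcp, Finset.sum_range_zero]
        exact Nat.zero_le _
      · rw [if_neg hE', if_neg hE']
        have key : 2 * (q - S) + c + 2 ≤ k - S := by
          rcases Nat.eq_zero_or_pos e with he | he
          · subst he; rw [Nat.zero_mul] at hUB; omega
          · obtain ⟨hl1, hl2⟩ : (e + 1) * S = e * S + S ∧ (e + 1) * q = e * q + q := ⟨by ring, by ring⟩
            obtain ⟨hl3, hl4⟩ : (e - 1) * S = e * S - S ∧ (e - 1) * j = e * j - j := ⟨Nat.sub_one_mul e S, Nat.sub_one_mul e j⟩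
            obtain ⟨hS1, hj1⟩ : S ≤ e * S ∧ j ≤ e * j := ⟨Nat.le_mul_of_pos_left S he, Nat.le_mul_of_pos_left j he⟩
            have hF2 := hF.2
            have hprod : (e - 1) * S ≤ (e - 1) * j := Nat.mul_le_mul_left _ (by omega)
            obtain ⟨hl5, hl6⟩ : (e + 1) * (2 * q) = 2 * (e * q) + 2 * q ∧ (e + 1) * (j + S) = e * j + e * S + j + S := ⟨by ring, by ring⟩
            have hA : (e + 1) * (2 * q) ≤ (e + 1) * (j + S) := by omega
            have hB : 2 * q ≤ j + S := Nat.le_of_mul_le_mul_left hA (Nat.succ_pos e)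
            omega
        rw [min_eq_left (show q - S ≤ k - S - (q - S) - c by omega),
          min_eq_left (show q + 1 - S ≤ k - S - (q + 1 - S) - c by omega), show q + 1 - S = q - S + 1 by omega]
        exact corr_add_corr_le p hp c (k - S) (q - S) hcp (by omega)

/-- **(MONO) THE MODULAR RANK DROP OF THE UNIT COLUMN GROWS ALONG LATTICE STEPS IN THE LOWER WINDOW.** For a field `K` of prime characteristic
`p`, a field `K₀` of characteristic `0`, `c < p`, and the levels `j`, `j + (e+1)` with (H1) `j + c + 2 ≤ k` and (H2) `2j + (e+1)(c+2) ≤ (e+1)k`: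
`rank_{K₀}(j) − rank_K(j) ≤ rank_{K₀}(j+e+1) − rank_K(j+e+1)`, stated additively — anchor 229's multiplicity matrix of `×q^c` on
`K[x₁,…,x_k]/(xᵢ^{e+2})` (VERBATIM). From anchor 304's (DROP) at both levels and (MONO-summand) summed over the labels. (H2) says the step ends
at or below the centre `(e+1)(k−c)/2` of anchor 312's symmetry; (H1) is what the termwise comparison needs: for `e = 1` (H1) ⟺ (H2), for `e = 0`
(H2) ⟹ (H1) — so for `d ≤ 3` the whole lower half is covered (cubics: with anchor 312 the drop is unimodal along each parity class of levels);
for `e ≥ 2` the levels `k − c − 2 < j ≤ (e+1)(k−c)/2 − (e+1)` are not treated here (own numerics: no violation there either). -/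
theorem rank_charZero_add_rank_charP_le (K K₀ : Type*) [Field K] [Field K₀] (p : ℕ) [CharP K p] [CharZero K₀] (hp : p.Prime)
    (k e c j : ℕ) (hcp : c < p) (h1 : j + c + 2 ≤ k) (h2 : 2 * j + (e + 1) * (c + 2) ≤ (e + 1) * k) :
    (Matrix.of fun (v : {v : Fin k → Fin (e + 2) // (∑ i, (v i : ℕ)) + j = k * (e + 1)})
        (m : {m : Fin k → Fin (e + 2) // (∑ i, (m i : ℕ)) + (j + c * (e + 1)) = k * (e + 1)}) =>
      ((((List.flatMap (colR (e + 3)))^[c] [List.ofFn (fun i => (m.1 i : ℕ))]).count (List.ofFn (fun i => (v.1 i : ℕ))) : ℕ) : K₀)).rank +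
    (Matrix.of fun (v : {v : Fin k → Fin (e + 2) // (∑ i, (v i : ℕ)) + (j + (e + 1)) = k * (e + 1)})
        (m : {m : Fin k → Fin (e + 2) // (∑ i, (m i : ℕ)) + (j + (e + 1) + c * (e + 1)) = k * (e + 1)}) =>
      ((((List.flatMap (colR (e + 3)))^[c] [List.ofFn (fun i => (m.1 i : ℕ))]).count (List.ofFn (fun i => (v.1 i : ℕ))) : ℕ) : K)).rank ≤
    (Matrix.of fun (v : {v : Fin k → Fin (e + 2) // (∑ i, (v i : ℕ)) + (j + (e + 1)) = k * (e + 1)})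
        (m : {m : Fin k → Fin (e + 2) // (∑ i, (m i : ℕ)) + (j + (e + 1) + c * (e + 1)) = k * (e + 1)}) =>
      ((((List.flatMap (colR (e + 3)))^[c] [List.ofFn (fun i => (m.1 i : ℕ))]).count (List.ofFn (fun i => (v.1 i : ℕ))) : ℕ) : K₀)).rank +
    (Matrix.of fun (v : {v : Fin k → Fin (e + 2) // (∑ i, (v i : ℕ)) + j = k * (e + 1)})
        (m : {m : Fin k → Fin (e + 2) // (∑ i, (m i : ℕ)) + (j + c * (e + 1)) = k * (e + 1)}) =>
      ((((List.flatMap (colR (e + 3)))^[c] [List.ofFn (fun i => (m.1 i : ℕ))]).count (List.ofFn (fun i => (v.1 i : ℕ))) : ℕ) : K)).rank := by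
  have H := UnitColumnRankDrop.rank_charP_add_eq_rank_charZero_add K K₀ p hp k e c j hcp
  have H' := UnitColumnRankDrop.rank_charP_add_eq_rank_charZero_add K K₀ p hp k e c (j + (e + 1)) hcp
  have hsum := Finset.sum_le_sum (fun μ (_ : μ ∈ (Finset.univ : Finset (Fin k → Fin (e + 1)))) =>
    summand_add_summand_le p k e c j μ hp hcp h1 h2)
  rw [Finset.sum_add_distrib, Finset.sum_add_distrib] at hsum
  omega

end Summit.HodgeConjecture.HodgeConjecture.HodgeLocus.Census.UnitColumnRankDropMonotone
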